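import Summits.ResolutionOfSingularities.ResolutionOfSingularities.Theorems.HilbertStallCert
import Summits.ResolutionOfSingularities.ResolutionOfSingularities.Theorems.UltraWalkInhabitant
import HarnessLib

/-!
# HilbertStall — the decided stall classes are INHABITED and the stall index is NOT downward closed

Node «HilbertStall» (decomp-res lens-3, g31), annex.  The Fermat quintic `F = x₀⁵ + x₁⁵ + x₂⁵` over `𝔽₂` at `q = 2`
(g30's `UltraWalk.fermat5`): its top ideal is `J_F = (x₀⁴, x₁⁴, x₂⁴)` (`D^{(e_l)}F = x_l⁴` in characteristic `2`), a
monomial ideal whose Hilbert–Samuel function stalls EXACTLY at index `10`: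
* `not_stall_fermat5_nine : ¬ Stall 2 fermat5 9` — the monomial `x₀³x₁³x₂³` of degree `9` has coefficient functional
  vanishing on `J_F + 𝔪^10`;
* `stall_fermat5_ten : Stall 2 fermat5 10` — every exponent of degree `≥ 10` in three variables has a coordinate `≥ 4`;
* `stall_fermat5_iff : Stall 2 fermat5 k ↔ 10 ≤ k`; hence by the LAW `isolatedTopCert_of_stall` an isolation
  certificate of the explicit size `stallSize (Fin 3) 10 5` and `IsolatedTop 2 fermat5` — the class `Stall · · 10` at
  `(q, D) = (2, 5)` is inhabited, and `Stall q F (k+1) → Stall q F k` FAILS (probe F7).  Kernel proofs only (no compiled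
decision procedures).
-/

set_option linter.dupNamespace false

noncomputable section

open MvPolynomial
open Literature.AlgebraicGeometry.Resolution
open Summit.ResolutionOfSingularities.ResolutionOfSingularities.Theorems.TightDefectClasses
open Summit.ResolutionOfSingularities.ResolutionOfSingularities.Theorems.UltraWalk

namespace Summit.ResolutionOfSingularities.ResolutionOfSingularities.Theorems.HilbertStall

/-- SHARP PIGEONHOLE on exponents: degree `> card σ · (N − 1)` forces a coordinate `≥ N`. [folklore] -/
theorem exists_coord_ge_of_lt {σ : Type} [Fintype σ] {b : σ →₀ ℕ} {N : ℕ} (hb : Fintype.card σ * (N - 1) < b.degree) :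
    ∃ l, N ≤ b l := by
  by_contra h0
  have h : ∀ l, b l < N := fun l => not_le.mp fun hl => h0 ⟨l, hl⟩
  have hsum : b.degree ≤ Fintype.card σ * (N - 1) := by
    rw [Finsupp.degree_eq_sum]
    calc ∑ i, b i ≤ ∑ _i : σ, (N - 1) := Finset.sum_le_sum fun i _ => Nat.le_sub_one_of_lt (h i)
      _ = Fintype.card σ * (N - 1) := by rw [Finset.sum_const, smul_eq_mul, Finset.card_univ]
  omega

/-- An exponent on `Fin 3` of degree `< 2` that is non-zero is a unit vector. [folklore] -/
theorem eq_single_of_degree_lt_two {d : Fin 3 →₀ ℕ} (h0 : d ≠ 0) (h2 : d.degree < 2) : ∃ l, d = Finsupp.single l 1 := by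
  have hsum : d.degree = d 0 + d 1 + d 2 := by rw [Finsupp.degree_eq_sum, Fin.sum_univ_three]
  have hlt : d 0 + d 1 + d 2 < 2 := hsum ▸ h2
  have hne : d 0 ≠ 0 ∨ d 1 ≠ 0 ∨ d 2 ≠ 0 := by
    by_contra hall
    simp only [not_or, not_not] at hall
    exact h0 (Finsupp.ext fun i => by fin_cases i <;> simp [hall])
  rcases hne with h | h | h
  · refine ⟨0, Finsupp.ext fun i => ?_⟩
    fin_cases i <;> simp <;> omega
  · refine ⟨1, Finsupp.ext fun i => ?_⟩
    fin_cases i <;> simp <;> omega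
  · refine ⟨2, Finsupp.ext fun i => ?_⟩
    fin_cases i <;> simp <;> omega

/-- The generators `x_l⁴` lie in the top ideal of the quintic at `q = 2`. [folklore] -/
theorem X_pow_four_mem_topIdeal_fermat5 (l : Fin 3) :
    (X l ^ 4 : MvPolynomial (Fin 3) (ZMod 2)) ∈ topIdeal 2 fermat5 := by
  rw [← hasseDeriv_single_one_fermat5 l]
  refine Ideal.subset_span ⟨Finsupp.single l 1, ⟨Finsupp.single_ne_zero.mpr one_ne_zero, ?_⟩, rfl⟩
  rw [Finsupp.degree_single]; exact Nat.one_lt_two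

/-- The top ideal of the quintic at `q = 2` is contained in (indeed equals) the monomial ideal `(x₀⁴, x₁⁴, x₂⁴)`.
[folklore] -/
theorem topIdeal_fermat5_le :
    topIdeal 2 fermat5 ≤ Ideal.span (Set.range fun l : Fin 3 => (X l ^ 4 : MvPolynomial (Fin 3) (ZMod 2))) := by
  refine Ideal.span_le.mpr ?_
  rintro _ ⟨d, ⟨hd0, hd2⟩, rfl⟩
  obtain ⟨l, rfl⟩ := eq_single_of_degree_lt_two hd0 hd2
  show hasseDeriv (ZMod 2) (Finsupp.single l 1) fermat5 ∈ Ideal.span (Set.range fun l : Fin 3 => X l ^ 4)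
  rw [hasseDeriv_single_one_fermat5]
  exact Ideal.subset_span ⟨l, rfl⟩

/-- The diagonal exponent `(3, 3, 3)`. DEFINITION (support). [folklore] -/
def diag3 : Fin 3 →₀ ℕ := Finsupp.single 0 3 + Finsupp.single 1 3 + Finsupp.single 2 3

/-- Its coordinates are all `3`. [folklore] -/
theorem diag3_apply (l : Fin 3) : diag3 l = 3 := by
  fin_cases l <;> simp [diag3]

/-- Its degree is `9`. [folklore] -/
theorem degree_diag3 : diag3.degree = 9 := by
  rw [Finsupp.degree_eq_sum, Fin.sum_univ_three, diag3_apply, diag3_apply, diag3_apply]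

/-- **`¬ Stall 2 fermat5 9`** — the Hilbert–Samuel function of `𝔽₂[x]/(x₀⁴, x₁⁴, x₂⁴)` has NOT stalled at index `9`:
`x₀³x₁³x₂³ ∉ J_F + 𝔪^10` (coefficient functional at `(3,3,3)`). [folklore] -/
theorem not_stall_fermat5_nine : ¬ Stall 2 fermat5 9 := by
  intro h
  have hmem : monomial diag3 (1 : ZMod 2) ∈ idealOfVars (Fin 3) (ZMod 2) ^ 9 := monomial_mem_pow_of_le degree_diag3.ge 1
  obtain ⟨j, hj, r, hr, hjr⟩ := Submodule.mem_sup.mp (h hmem)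
  obtain ⟨u, hu⟩ := (Submodule.mem_span_range_iff_exists_fun _).mp (topIdeal_fermat5_le hj)
  have h1 : coeff diag3 j = 0 := by
    rw [← hu, coeff_sum]
    refine Finset.sum_eq_zero fun l _ => ?_
    rw [smul_eq_mul, X_pow_eq_monomial, coeff_mul_monomial', if_neg]
    intro hle
    have h4 := Finsupp.le_def.mp hle l
    rw [Finsupp.single_eq_same, diag3_apply] at h4
    omega
  have h2 : coeff diag3 r = 0 := by
    by_contra hne
    rw [mem_pow_idealOfVars_iff] at hr
    have h10 := hr diag3 (mem_support_iff.mpr hne)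
    rw [degree_diag3] at h10
    omega
  have h3 := congrArg (coeff diag3) hjr
  rw [coeff_add, h1, h2, zero_add, coeff_monomial, if_pos rfl] at h3
  exact zero_ne_one h3

/-- **`Stall 2 fermat5 10`** — every exponent of degree `≥ 10` in three variables has a coordinate `≥ 4`, so
`𝔪^10 ≤ (x₀⁴, x₁⁴, x₂⁴) = J_F`. [folklore] -/
theorem stall_fermat5_ten : Stall 2 fermat5 10 := by
  intro x hx
  refine Submodule.mem_sup_left ?_
  rw [mem_pow_idealOfVars_iff] at hx
  rw [as_sum x]
  refine Ideal.sum_mem _ fun m hm => ?_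
  obtain ⟨l, hl⟩ : ∃ l, 4 ≤ m l :=
    exists_coord_ge_of_lt (by have h10 := hx m hm; rw [Fintype.card_fin]; omega)
  have hmono : monomial m (coeff m x) = monomial (m - Finsupp.single l 4) (coeff m x) * X l ^ 4 := by
    rw [X_pow_eq_monomial, monomial_mul, mul_one, tsub_add_cancel_of_le (Finsupp.single_le_iff.mpr hl)]
  rw [hmono]
  exact Ideal.mul_mem_left _ _ (X_pow_four_mem_topIdeal_fermat5 l)

/-- **THE STALL INDEX OF THE QUINTIC IS EXACTLY 10**: `Stall 2 fermat5 k ↔ 10 ≤ k`. [folklore] -/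
theorem stall_fermat5_iff (k : ℕ) : Stall 2 fermat5 k ↔ 10 ≤ k :=
  ⟨fun h => not_lt.mp fun hk => not_stall_fermat5_nine (stall_mono_index (Nat.le_of_lt_succ hk) h),
    fun hk => stall_mono_index hk stall_fermat5_ten⟩

/-- **THE DECIDED CLASS IS INHABITED**: by the LAW, the quintic has an isolation certificate of the explicit size
`stallSize (Fin 3) 10 5` at `q = 2`. [folklore] -/
theorem isolatedTopCert_fermat5_stallSize : IsolatedTopCert 2 (stallSize (Fin 3) 10 5) fermat5 :=
  isolatedTopCert_of_stall totalDegree_fermat5_le stall_fermat5_ten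

/-- Hence `IsolatedTop 2 fermat5` (through the law, not through g30's hand certificate). [folklore] -/
theorem isolatedTop_fermat5 : IsolatedTop 2 fermat5 :=
  isolatedTop_of_cert isolatedTopCert_fermat5_stallSize

/-- **THE STALL INDEX IS NOT DOWNWARD CLOSED** (probe F7 decided): `¬ ∀ q K F k, Stall q F (k+1) → Stall q F k`.
[folklore] -/
theorem not_stall_downward :
    ¬ ∀ (q : ℕ) (K : Type) [Field K] (F : MvPolynomial (Fin 3) K) (k : ℕ), Stall q F (k + 1) → Stall q F k :=
  fun h => not_stall_fermat5_nine (h 2 (ZMod 2) fermat5 9 stall_fermat5_ten)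

end Summit.ResolutionOfSingularities.ResolutionOfSingularities.Theorems.HilbertStall

end
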